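/-
Copyright: the b2b-balaban T⁴-continuum CRUX team, row NE7b OWNER lineage `t4-ne7b-p1` (gen 142). Project licence.
-/
import Summits.QuantumFields.BalabanUV.T4Continuum.Spine.NE7b.SupBlockFourthKernelAverage
import Summits.QuantumFields.BalabanUV.T4Continuum.Spine.NE7b.SupWhitenedFourthTwoPointEntries
import Summits.QuantumFields.BalabanUV.T4Continuum.Spine.NE7b.SupWhitenedFourthTwoPointEntriesTwo
import Summits.QuantumFields.BalabanUV.T4Continuum.Spine.NE7b.SupFourthKernelTwoPointLetters
import Summits.QuantumFields.BalabanUV.T4Continuum.Spine.NE7b.SupWhitenedMixedThreePointRowLetters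
import Summits.QuantumFields.BalabanUV.T4Continuum.Spine.NE7b.SupWhitenedFourthKernelPieces

/-!
# THE ORDER-FOUR KERNEL LETTER OF THE FLUCTUATION STEP, ASSEMBLED, FOR A GENERAL `Γ = AAᵀ` (SCOPING (d13)(2), eleventh file — THE END of
# order four's letter).  (521) displayed the fourth derivative of the next potential `W(ψ) = −log∫e^{−U(ω+ψ)}dN(0,AAᵀ)(ω)` along `e_x` at
# `(e_y,e_z,e_t)` as average − four two-point covariances − three Hessian pairs + six centred triples − `κ₄`, every piece a tilted integral
# with the `e_x`-factor first.  Summing `|·|` over `(y,z,t)` piece by piece — (500) the average, (501)∕(502) entries + (512) letters for the two-point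
# pieces, (511) for the three-point pieces, (522) for `κ₄` ((498) bridged, `M₆` discharged), the other slot placements by (522)'s reindexings —
#   `Σ_{y,z,t} |∂⁴W(ψ)[e_y,e_z,e_t,e_x]| ≤ κ₄r + (3αr·k4r·(αc·hc) + hr·αr·(αc·k4c) + 3αr·k3r·(αc·k3c))·dr·dc∕(1−lamA) + 6n·4√(MK)S² + C₄·16S′³`
# UNIFORMLY IN THE BACKGROUND `ψ`, THE SITE `x` AND THE VOLUME, for the road's SINGULAR finite-range `Γ = AAᵀ` — NO precision condition; every
# hypothesis a class letter (`κ₂, κ₃, κ₄`; majorants `Hk, K3, K4` with row∕column∕fixed-slot letters; the fourth row letter `κ₄r` of `U⁗`), a factor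
# letter (`αr, αc, lamA`), an admissible `D` with its plain∕weighted letters, a geometry letter (weights `θ, σ, ρ, r`, site letters `S, S′`, support
# count `n`) or a smallness (row NE7b, node U5c; (500), (501), (502), (511), (512), (522) BY NAME; [folklore]; Gross 1979 ∕ Künsch 1982 territory)

Cell `pub-balaban`, sub-cell `t4`, spine estimate NE7b (`T4WeightBudget.RelWeightBound`; the cell's OWN estimate — NOT PRINTED in
[Bałaban 1983–89], NOT PROVED).  Crux-route work under `Spine/NE7b/` by the row OWNER (`t4-ne7b-p1` gen 142, file (523)) under FREEZE
(0)'s crux-prover clause; NOTHING of Bałaban's is named as a Lean object, valued or asserted; no `T4Continuum/Support` leaf typed; no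
`def`, no notation (the centred display WRITTEN OUT as in (521)); zero `sorry`.  Imports (BY NAME): the OWNER's (500) `…SupBlockFourthKernelAverage`
(`tilted_fourth_average_rowsum`), (501) `…SupWhitenedFourthTwoPointEntries` (`thirdgrad_cov_entry`), (502) `…SupWhitenedFourthTwoPointEntriesTwo`
(`gradthird_cov_entry`, `hesshess_cov_entry`), (512) `…SupFourthKernelTwoPointLetters` (`two_point_lone_last_sum_le`, `two_point_lone_first_sum_le`,
`two_point_pairing_sum_le`), (511) `…SupWhitenedMixedThreePointRowLetters` (`mixed_three_point_row_letter`, `…_two`), (522)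
`…SupWhitenedFourthKernelPieces` (`sum3_*`, `fourth_cumulant_row_letter_tilted`, `abs_fifteen_split`); (458) `posSemidef_AAT`, (313)
`mul_opBound_le_of_le` through them.

WHAT IS PROVED ([folklore]): THE END **`whitened_fourth_kernel_letter`**; §2 toy.

HONEST (what this is NOT).  Letters: the triple row sum of the output's FOURTH kernel (in (521)'s centred form, which IS `∂⁴W` along `e_x` by
(521) `hasDerivAt_third_form_line_centred`) is bounded by the input's letters of orders two–four and the factor's letters, general `Γ = AAᵀ`;
the GEOMETRY letters (weights, `D`, `S, S′, n`; `αr, αc`) are NOT discharged here for the road's finite-range factor ((476)∕(499)∕(485)∕(510)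
supply them; the finite-range corollary is the next file); the order-4 block of the kernel-letter CLASS MAP (entry majorant `K4⁺`, four fixed-slot
letters, Schur) and the Fréchet∕`C⁴` repackaging are NOT typed; order five NOT typed.  Scalar skeleton ((A3), NC-NE7b-α UNRULED); nothing of
Bałaban's asserted.  BY-NAME EFFECT ON THE WALL: NONE.  NE7b NOT PRINTED ∕ NOT PROVED; spine PROVED 0∕9; rung (B)+1 — the programme's measures
remain FINITE-torus statements; NOT the mass gap, NOT Clay.  HONEST DEPENDENCY: continuum YM on T⁴ ⇐ BetaPertH ∧ nine spine estimates (0∕9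
proved); BetaPertH ⇐ (D1) ∧ (D4) ∧ CAP+tail; G-an2-4 gates asym, D1 and NE2∕3∕4.
-/

set_option autoImplicit false
set_option maxSynthPendingDepth 3

noncomputable section

namespace Summit.QuantumFields.BalabanUV.T4Continuum.NE7b.SupWhitenedFourthKernelLetter

open MeasureTheory ProbabilityTheory Finset Real Matrix
open scoped BigOperators Matrix
open SupEffectiveActionDerivative (mul_opBound_le_of_le)
open SupWhitenedMomentLetters (posSemidef_AAT)
open SupBlockFourthKernelAverage (tilted_fourth_average_rowsum)
open SupWhitenedFourthTwoPointEntries (thirdgrad_cov_entry)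
open SupWhitenedFourthTwoPointEntriesTwo (gradthird_cov_entry hesshess_cov_entry)
open SupFourthKernelTwoPointLetters (two_point_lone_last_sum_le two_point_lone_first_sum_le two_point_pairing_sum_le)
open SupWhitenedMixedThreePointRowLetters (mixed_three_point_row_letter mixed_three_point_row_letter_two)
open SupWhitenedFourthKernelPieces (sum3_swap12 sum3_swap23 sum3_cycle sum3_cycle' fourth_cumulant_row_letter_tilted abs_fifteen_split)

variable {ι κ : Type} [Fintype ι] [DecidableEq ι] [Fintype κ] [DecidableEq κ]

section TheEnd

variable {U : EuclideanSpace ℝ ι → ℝ} {U' : EuclideanSpace ℝ ι → EuclideanSpace ℝ ι →L[ℝ] ℝ}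
  {U'' : EuclideanSpace ℝ ι → EuclideanSpace ℝ ι →L[ℝ] EuclideanSpace ℝ ι →L[ℝ] ℝ}
  {U₃ : EuclideanSpace ℝ ι → EuclideanSpace ℝ ι →L[ℝ] EuclideanSpace ℝ ι →L[ℝ] EuclideanSpace ℝ ι →L[ℝ] ℝ}
  {U₄ : EuclideanSpace ℝ ι → EuclideanSpace ℝ ι →L[ℝ] EuclideanSpace ℝ ι →L[ℝ] EuclideanSpace ℝ ι →L[ℝ] EuclideanSpace ℝ ι →L[ℝ] ℝ}
  {Hk : ι → ι → ℝ} {K3 : ι → ι → ι → ℝ} {K4 : ι → ι → ι → ι → ℝ} {A : Matrix ι κ ℝ} {D : κ → κ → ℝ}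
  {γop κ₀ κ₁ κ₂ κ₃ κ₄ κ₄r a τ δ θp lam lamA αr αc hr hc k3r k3c k4r k4c γ dr dc dθ dθ' αθ βθ S S' : ℝ} {θ : κ → κ → ℝ} {σ : ι → κ → ℝ}
  {ρ r : ι → ι → ℝ} {n : ℕ}
set_option maxHeartbeats 400000 in
/-- **THE END — THE ORDER-FOUR KERNEL LETTER OF THE FLUCTUATION STEP, GENERAL `Γ = AAᵀ`**: the triple row sum of the absolute fourth
derivative of the next potential (in (521)'s centred form, differentiation direction `e_x` first) is bounded by the input class letters of orders
two–four, the factor's letters, the admissible `D`'s letters, the geometry letters and the smallness — uniformly in `ψ`, `x` and the volume. [folklore] -/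
theorem whitened_fourth_kernel_letter [Nonempty κ] (hΓop : (γop • (1 : Matrix ι ι ℝ) - A * Aᵀ).PosSemidef) (Y : Finset ι)
    (hUd : ∀ φ : EuclideanSpace ℝ ι, HasFDerivAt U (U' φ) φ) (hU'd : ∀ φ : EuclideanSpace ℝ ι, HasFDerivAt U' (U'' φ) φ)
    (hU''d : ∀ φ : EuclideanSpace ℝ ι, HasFDerivAt U'' (U₃ φ) φ) (hU₃d : ∀ φ : EuclideanSpace ℝ ι, HasFDerivAt U₃ (U₄ φ) φ) (hU₄c : Continuous U₄)
    (hκ₀ : 0 ≤ κ₀) (hκ₁ : 0 ≤ κ₁) (ha : 0 ≤ a) (hτ : 0 < τ) (hδ : 0 < δ) (hθ0 : 0 < θp) (hθ1 : θp < 1)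
    (hκθ : (2 * κ₀ * (1 + τ) + 4 * δ) * γop ≤ θp) (hκθw : 2 * κ₀ * (1 + τ) * γop + 4 * δ ≤ θp)
    (hstab : ∀ φ : EuclideanSpace ℝ ι, -(κ₀ * ∑ x ∈ Y, φ x ^ 2) ≤ U φ)
    (hU'b : ∀ φ : EuclideanSpace ℝ ι, ‖U' φ‖ ≤ κ₁ * (a + ∑ x ∈ Y, φ x ^ 2)) (hU''b : ∀ φ : EuclideanSpace ℝ ι, ‖U'' φ‖ ≤ κ₂)
    (hU₃b : ∀ φ : EuclideanSpace ℝ ι, ‖U₃ φ‖ ≤ κ₃) (hU₄b : ∀ φ : EuclideanSpace ℝ ι, ‖U₄ φ‖ ≤ κ₄) (hlam : 0 ≤ lam)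
    (hUsec : ∀ s : ℝ, 0 ≤ s → s ≤ 1 → ∀ a b : EuclideanSpace ℝ ι,
      U ((1 - s) • a + s • b) - lam / 2 * (s * (1 - s)) * ∑ i, (a i - b i) ^ 2 ≤ (1 - s) * U a + s * U b)
    (hρg : lam * γop < 1)
    -- the majorants of orders two, three, four and their letters
    (hHk : ∀ (φ : EuclideanSpace ℝ ι) (x z : ι), |U'' φ (EuclideanSpace.single z (1 : ℝ)) (EuclideanSpace.single x (1 : ℝ))| ≤ Hk x z)
    (hHk0 : ∀ v u, 0 ≤ Hk v u)
    (hK3 : ∀ (φ : EuclideanSpace ℝ ι) (u x y : ι),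
      |U₃ φ (EuclideanSpace.single u (1 : ℝ)) (EuclideanSpace.single x (1 : ℝ)) (EuclideanSpace.single y (1 : ℝ))| ≤ K3 x y u)
    (hK30 : ∀ x y u, 0 ≤ K3 x y u)
    (hK4 : ∀ (φ : EuclideanSpace ℝ ι) (u x y z : ι), |U₄ φ (EuclideanSpace.single u (1 : ℝ)) (EuclideanSpace.single x (1 : ℝ))
      (EuclideanSpace.single y (1 : ℝ)) (EuclideanSpace.single z (1 : ℝ))| ≤ K4 x y z u)
    (hK40 : ∀ x y z u, 0 ≤ K4 x y z u)
    (hU₄row : ∀ (φ : EuclideanSpace ℝ ι) (x : ι), ∑ y, ∑ z, ∑ t, |U₄ φ (EuclideanSpace.single x (1 : ℝ)) (EuclideanSpace.single y (1 : ℝ))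
      (EuclideanSpace.single z (1 : ℝ)) (EuclideanSpace.single t (1 : ℝ))| ≤ κ₄r)
    (hhr : ∀ v, ∑ u, Hk v u ≤ hr) (hhc : ∀ u, ∑ v, Hk v u ≤ hc) (hk3r : ∀ x, ∑ y, ∑ u, K3 x y u ≤ k3r) (hk3c : ∀ u, ∑ y, ∑ z, K3 y z u ≤ k3c)
    (hk4r : ∀ x, ∑ y, ∑ z, ∑ u, K4 x y z u ≤ k4r) (hk4c : ∀ u, ∑ y, ∑ z, ∑ t, K4 y z t u ≤ k4c)
    -- the factor's letters and the smallness
    (ψ : EuclideanSpace ℝ ι) (hαr : ∀ u, ∑ w, |A u w| ≤ αr) (hαc : ∀ w, ∑ u, |A u w| ≤ αc)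
    (hlamA : ∀ x : κ, ∑ u, ∑ v, |A u x| * |A v x| * Hk v u ≤ lamA) (hlamA1 : lamA < 1) (hγ : αc * hr * αr / (1 - lamA) ≤ γ) (hγ1 : γ < 1)
    -- the admissible `D` (plain and weighted letters), the weights `θ, σ, ρ, r`, the weighted profiles, the site letters, the support count
    (hD : ∀ x y, 0 ≤ D x y)
    (hDC : ∀ x y, (if x = y then (1 : ℝ) else 0) + ∑ z, D x z * ((if y = z then 0 else ∑ u, ∑ v, |A u y| * |A v z| * Hk v u) / (1 - lamA)) ≤ D x y)
    (hDr : ∀ z, ∑ w, D z w ≤ dr) (hDc : ∀ w, ∑ z, D z w ≤ dc)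
    (hθnn : ∀ z w, 0 ≤ θ z w) (hDθr : ∀ z, ∑ w, D z w * θ z w ≤ dθ) (hdθ : 0 ≤ dθ) (hDθc : ∀ w, ∑ z, D z w * θ z w ≤ dθ') (hdθ' : 0 ≤ dθ')
    (hσ0 : ∀ x w, 0 ≤ σ x w) (hσθ : ∀ x z w, σ x w ≤ σ x z * θ z w)
    (hρ1 : ∀ x y, 1 ≤ ρ x y) (hρsymm : ∀ x y, ρ x y = ρ y x) (hρmul : ∀ x y z, ρ x z ≤ ρ x y * ρ y z) (hρσ : ∀ x y w, ρ x y ^ 8 ≤ σ x w * σ y w)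
    (hr1 : ∀ x y, 1 ≤ r x y) (hrσ : ∀ x y w, r x y ^ 24 ≤ σ x w * σ y w)
    (haσ : ∀ v : ι, ∑ w, (∑ u, |A u w| * Hk v u) * σ v w ≤ αθ) (hβ : 0 ≤ βθ) (haσ' : ∀ (v : ι) (w : κ), (∑ u, |A u w| * Hk v u) * σ v w ≤ βθ)
    (hgσ : ∀ x y : ι, ∑ w, (∑ u, |A u w| * K3 x y u) * σ x w ≤ αθ) (hgσ' : ∀ (x y : ι) (w : κ), (∑ u, |A u w| * K3 x y u) * σ x w ≤ βθ)
    (x : ι) (hS : ∑ v, 1 / ρ x v ≤ S) (hSr : ∀ u, ∑ v, (r u v ^ 2)⁻¹ ≤ S') (hSc : ∀ v, ∑ u, (r u v ^ 2)⁻¹ ≤ S')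
    (hn : ∀ y : ι, (Finset.univ.filter (fun z => Hk z y ≠ 0)).card ≤ n) :
    ∑ y, ∑ z, ∑ t, |(∫ ω : EuclideanSpace ℝ ι, exp (-U (ω + ψ)) ∂(multivariateGaussian 0 (A * Aᵀ)))⁻¹ * (∫ ω : EuclideanSpace ℝ ι, exp (-U (ω + ψ)) *
        U₄ (ω + ψ) (EuclideanSpace.single x (1 : ℝ)) (EuclideanSpace.single y (1 : ℝ)) (EuclideanSpace.single z (1 : ℝ)) (EuclideanSpace.single t (1
        : ℝ)) ∂(multivariateGaussian 0 (A * Aᵀ))) -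
        (((∫ ω : EuclideanSpace ℝ ι, exp (-U (ω + ψ)) ∂(multivariateGaussian 0 (A * Aᵀ)))⁻¹ * (∫ ω : EuclideanSpace ℝ ι, exp (-U (ω + ψ)) * (U₃ (ω +
            ψ) (EuclideanSpace.single x (1 : ℝ)) (EuclideanSpace.single z (1 : ℝ)) (EuclideanSpace.single t (1 : ℝ)) * U' (ω + ψ)
            (EuclideanSpace.single y (1 : ℝ))) ∂(multivariateGaussian 0 (A * Aᵀ))) - ((∫ ω : EuclideanSpace ℝ ι, exp (-U (ω + ψ))
            ∂(multivariateGaussian 0 (A * Aᵀ))) ^ 2)⁻¹ * ((∫ ω : EuclideanSpace ℝ ι, exp (-U (ω + ψ)) * U₃ (ω + ψ) (EuclideanSpace.single x (1 : ℝ))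
            (EuclideanSpace.single z (1 : ℝ)) (EuclideanSpace.single t (1 : ℝ)) ∂(multivariateGaussian 0 (A * Aᵀ))) * (∫ ω : EuclideanSpace ℝ ι, exp
            (-U (ω + ψ)) * U' (ω + ψ) (EuclideanSpace.single y (1 : ℝ)) ∂(multivariateGaussian 0 (A * Aᵀ))))) + ((∫ ω : EuclideanSpace ℝ ι, exp (-U
            (ω + ψ)) ∂(multivariateGaussian 0 (A * Aᵀ)))⁻¹ * (∫ ω : EuclideanSpace ℝ ι, exp (-U (ω + ψ)) * (U₃ (ω + ψ) (EuclideanSpace.single x (1 :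
            ℝ)) (EuclideanSpace.single y (1 : ℝ)) (EuclideanSpace.single t (1 : ℝ)) * U' (ω + ψ) (EuclideanSpace.single z (1 : ℝ)))
            ∂(multivariateGaussian 0 (A * Aᵀ))) - ((∫ ω : EuclideanSpace ℝ ι, exp (-U (ω + ψ)) ∂(multivariateGaussian 0 (A * Aᵀ))) ^ 2)⁻¹ * ((∫ ω :
            EuclideanSpace ℝ ι, exp (-U (ω + ψ)) * U₃ (ω + ψ) (EuclideanSpace.single x (1 : ℝ)) (EuclideanSpace.single y (1 : ℝ))
            (EuclideanSpace.single t (1 : ℝ)) ∂(multivariateGaussian 0 (A * Aᵀ))) * (∫ ω : EuclideanSpace ℝ ι, exp (-U (ω + ψ)) * U' (ω + ψ)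
            (EuclideanSpace.single z (1 : ℝ)) ∂(multivariateGaussian 0 (A * Aᵀ))))) + ((∫ ω : EuclideanSpace ℝ ι, exp (-U (ω + ψ))
            ∂(multivariateGaussian 0 (A * Aᵀ)))⁻¹ * (∫ ω : EuclideanSpace ℝ ι, exp (-U (ω + ψ)) * (U₃ (ω + ψ) (EuclideanSpace.single x (1 : ℝ))
            (EuclideanSpace.single y (1 : ℝ)) (EuclideanSpace.single z (1 : ℝ)) * U' (ω + ψ) (EuclideanSpace.single t (1 : ℝ)))
            ∂(multivariateGaussian 0 (A * Aᵀ))) - ((∫ ω : EuclideanSpace ℝ ι, exp (-U (ω + ψ)) ∂(multivariateGaussian 0 (A * Aᵀ))) ^ 2)⁻¹ * ((∫ ω :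
            EuclideanSpace ℝ ι, exp (-U (ω + ψ)) * U₃ (ω + ψ) (EuclideanSpace.single x (1 : ℝ)) (EuclideanSpace.single y (1 : ℝ))
            (EuclideanSpace.single z (1 : ℝ)) ∂(multivariateGaussian 0 (A * Aᵀ))) * (∫ ω : EuclideanSpace ℝ ι, exp (-U (ω + ψ)) * U' (ω + ψ)
            (EuclideanSpace.single t (1 : ℝ)) ∂(multivariateGaussian 0 (A * Aᵀ))))) + ((∫ ω : EuclideanSpace ℝ ι, exp (-U (ω + ψ))
            ∂(multivariateGaussian 0 (A * Aᵀ)))⁻¹ * (∫ ω : EuclideanSpace ℝ ι, exp (-U (ω + ψ)) * (U' (ω + ψ) (EuclideanSpace.single x (1 : ℝ)) * U₃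
            (ω + ψ) (EuclideanSpace.single y (1 : ℝ)) (EuclideanSpace.single z (1 : ℝ)) (EuclideanSpace.single t (1 : ℝ))) ∂(multivariateGaussian 0
            (A * Aᵀ))) - ((∫ ω : EuclideanSpace ℝ ι, exp (-U (ω + ψ)) ∂(multivariateGaussian 0 (A * Aᵀ))) ^ 2)⁻¹ * ((∫ ω : EuclideanSpace ℝ ι, exp
            (-U (ω + ψ)) * U' (ω + ψ) (EuclideanSpace.single x (1 : ℝ)) ∂(multivariateGaussian 0 (A * Aᵀ))) * (∫ ω : EuclideanSpace ℝ ι, exp (-U (ω +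
            ψ)) * U₃ (ω + ψ) (EuclideanSpace.single y (1 : ℝ)) (EuclideanSpace.single z (1 : ℝ)) (EuclideanSpace.single t (1 : ℝ))
            ∂(multivariateGaussian 0 (A * Aᵀ)))))) -
        (((∫ ω : EuclideanSpace ℝ ι, exp (-U (ω + ψ)) ∂(multivariateGaussian 0 (A * Aᵀ)))⁻¹ * (∫ ω : EuclideanSpace ℝ ι, exp (-U (ω + ψ)) * (U'' (ω +
            ψ) (EuclideanSpace.single x (1 : ℝ)) (EuclideanSpace.single y (1 : ℝ)) * U'' (ω + ψ) (EuclideanSpace.single z (1 : ℝ))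
            (EuclideanSpace.single t (1 : ℝ))) ∂(multivariateGaussian 0 (A * Aᵀ))) - ((∫ ω : EuclideanSpace ℝ ι, exp (-U (ω + ψ))
            ∂(multivariateGaussian 0 (A * Aᵀ))) ^ 2)⁻¹ * ((∫ ω : EuclideanSpace ℝ ι, exp (-U (ω + ψ)) * U'' (ω + ψ) (EuclideanSpace.single x (1 : ℝ))
            (EuclideanSpace.single y (1 : ℝ)) ∂(multivariateGaussian 0 (A * Aᵀ))) * (∫ ω : EuclideanSpace ℝ ι, exp (-U (ω + ψ)) * U'' (ω + ψ)
            (EuclideanSpace.single z (1 : ℝ)) (EuclideanSpace.single t (1 : ℝ)) ∂(multivariateGaussian 0 (A * Aᵀ))))) + ((∫ ω : EuclideanSpace ℝ ι,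
            exp (-U (ω + ψ)) ∂(multivariateGaussian 0 (A * Aᵀ)))⁻¹ * (∫ ω : EuclideanSpace ℝ ι, exp (-U (ω + ψ)) * (U'' (ω + ψ)
            (EuclideanSpace.single x (1 : ℝ)) (EuclideanSpace.single z (1 : ℝ)) * U'' (ω + ψ) (EuclideanSpace.single y (1 : ℝ))
            (EuclideanSpace.single t (1 : ℝ))) ∂(multivariateGaussian 0 (A * Aᵀ))) - ((∫ ω : EuclideanSpace ℝ ι, exp (-U (ω + ψ))
            ∂(multivariateGaussian 0 (A * Aᵀ))) ^ 2)⁻¹ * ((∫ ω : EuclideanSpace ℝ ι, exp (-U (ω + ψ)) * U'' (ω + ψ) (EuclideanSpace.single x (1 : ℝ))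
            (EuclideanSpace.single z (1 : ℝ)) ∂(multivariateGaussian 0 (A * Aᵀ))) * (∫ ω : EuclideanSpace ℝ ι, exp (-U (ω + ψ)) * U'' (ω + ψ)
            (EuclideanSpace.single y (1 : ℝ)) (EuclideanSpace.single t (1 : ℝ)) ∂(multivariateGaussian 0 (A * Aᵀ))))) + ((∫ ω : EuclideanSpace ℝ ι,
            exp (-U (ω + ψ)) ∂(multivariateGaussian 0 (A * Aᵀ)))⁻¹ * (∫ ω : EuclideanSpace ℝ ι, exp (-U (ω + ψ)) * (U'' (ω + ψ)
            (EuclideanSpace.single x (1 : ℝ)) (EuclideanSpace.single t (1 : ℝ)) * U'' (ω + ψ) (EuclideanSpace.single y (1 : ℝ))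
            (EuclideanSpace.single z (1 : ℝ))) ∂(multivariateGaussian 0 (A * Aᵀ))) - ((∫ ω : EuclideanSpace ℝ ι, exp (-U (ω + ψ))
            ∂(multivariateGaussian 0 (A * Aᵀ))) ^ 2)⁻¹ * ((∫ ω : EuclideanSpace ℝ ι, exp (-U (ω + ψ)) * U'' (ω + ψ) (EuclideanSpace.single x (1 : ℝ))
            (EuclideanSpace.single t (1 : ℝ)) ∂(multivariateGaussian 0 (A * Aᵀ))) * (∫ ω : EuclideanSpace ℝ ι, exp (-U (ω + ψ)) * U'' (ω + ψ)
            (EuclideanSpace.single y (1 : ℝ)) (EuclideanSpace.single z (1 : ℝ)) ∂(multivariateGaussian 0 (A * Aᵀ)))))) +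
        ((∫ ω : EuclideanSpace ℝ ι, exp (-U (ω + ψ)) ∂(multivariateGaussian 0 (A * Aᵀ)))⁻¹ * (∫ ω : EuclideanSpace ℝ ι, exp (-U (ω + ψ)) * ((U'' (ω +
            ψ) (EuclideanSpace.single x (1 : ℝ)) (EuclideanSpace.single y (1 : ℝ)) - ((∫ ω : EuclideanSpace ℝ ι, exp (-U (ω + ψ))
            ∂(multivariateGaussian 0 (A * Aᵀ)))⁻¹ * (∫ ω : EuclideanSpace ℝ ι, exp (-U (ω + ψ)) * U'' (ω + ψ) (EuclideanSpace.single x (1 : ℝ))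
            (EuclideanSpace.single y (1 : ℝ)) ∂(multivariateGaussian 0 (A * Aᵀ))))) * (U' (ω + ψ) (EuclideanSpace.single z (1 : ℝ)) - ((∫ ω :
            EuclideanSpace ℝ ι, exp (-U (ω + ψ)) ∂(multivariateGaussian 0 (A * Aᵀ)))⁻¹ * (∫ ω : EuclideanSpace ℝ ι, exp (-U (ω + ψ)) * U' (ω + ψ)
            (EuclideanSpace.single z (1 : ℝ)) ∂(multivariateGaussian 0 (A * Aᵀ))))) * (U' (ω + ψ) (EuclideanSpace.single t (1 : ℝ)) - ((∫ ω :
            EuclideanSpace ℝ ι, exp (-U (ω + ψ)) ∂(multivariateGaussian 0 (A * Aᵀ)))⁻¹ * (∫ ω : EuclideanSpace ℝ ι, exp (-U (ω + ψ)) * U' (ω + ψ)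
            (EuclideanSpace.single t (1 : ℝ)) ∂(multivariateGaussian 0 (A * Aᵀ)))))) ∂(multivariateGaussian 0 (A * Aᵀ))) + (∫ ω : EuclideanSpace ℝ ι,
            exp (-U (ω + ψ)) ∂(multivariateGaussian 0 (A * Aᵀ)))⁻¹ * (∫ ω : EuclideanSpace ℝ ι, exp (-U (ω + ψ)) * ((U'' (ω + ψ)
            (EuclideanSpace.single x (1 : ℝ)) (EuclideanSpace.single z (1 : ℝ)) - ((∫ ω : EuclideanSpace ℝ ι, exp (-U (ω + ψ)) ∂(multivariateGaussian
            0 (A * Aᵀ)))⁻¹ * (∫ ω : EuclideanSpace ℝ ι, exp (-U (ω + ψ)) * U'' (ω + ψ) (EuclideanSpace.single x (1 : ℝ)) (EuclideanSpace.single z (1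
            : ℝ)) ∂(multivariateGaussian 0 (A * Aᵀ))))) * (U' (ω + ψ) (EuclideanSpace.single y (1 : ℝ)) - ((∫ ω : EuclideanSpace ℝ ι, exp (-U (ω +
            ψ)) ∂(multivariateGaussian 0 (A * Aᵀ)))⁻¹ * (∫ ω : EuclideanSpace ℝ ι, exp (-U (ω + ψ)) * U' (ω + ψ) (EuclideanSpace.single y (1 : ℝ))
            ∂(multivariateGaussian 0 (A * Aᵀ))))) * (U' (ω + ψ) (EuclideanSpace.single t (1 : ℝ)) - ((∫ ω : EuclideanSpace ℝ ι, exp (-U (ω + ψ))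
            ∂(multivariateGaussian 0 (A * Aᵀ)))⁻¹ * (∫ ω : EuclideanSpace ℝ ι, exp (-U (ω + ψ)) * U' (ω + ψ) (EuclideanSpace.single t (1 : ℝ))
            ∂(multivariateGaussian 0 (A * Aᵀ)))))) ∂(multivariateGaussian 0 (A * Aᵀ))) + (∫ ω : EuclideanSpace ℝ ι, exp (-U (ω + ψ))
            ∂(multivariateGaussian 0 (A * Aᵀ)))⁻¹ * (∫ ω : EuclideanSpace ℝ ι, exp (-U (ω + ψ)) * ((U'' (ω + ψ) (EuclideanSpace.single x (1 : ℝ))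
            (EuclideanSpace.single t (1 : ℝ)) - ((∫ ω : EuclideanSpace ℝ ι, exp (-U (ω + ψ)) ∂(multivariateGaussian 0 (A * Aᵀ)))⁻¹ * (∫ ω :
            EuclideanSpace ℝ ι, exp (-U (ω + ψ)) * U'' (ω + ψ) (EuclideanSpace.single x (1 : ℝ)) (EuclideanSpace.single t (1 : ℝ))
            ∂(multivariateGaussian 0 (A * Aᵀ))))) * (U' (ω + ψ) (EuclideanSpace.single y (1 : ℝ)) - ((∫ ω : EuclideanSpace ℝ ι, exp (-U (ω + ψ))
            ∂(multivariateGaussian 0 (A * Aᵀ)))⁻¹ * (∫ ω : EuclideanSpace ℝ ι, exp (-U (ω + ψ)) * U' (ω + ψ) (EuclideanSpace.single y (1 : ℝ))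
            ∂(multivariateGaussian 0 (A * Aᵀ))))) * (U' (ω + ψ) (EuclideanSpace.single z (1 : ℝ)) - ((∫ ω : EuclideanSpace ℝ ι, exp (-U (ω + ψ))
            ∂(multivariateGaussian 0 (A * Aᵀ)))⁻¹ * (∫ ω : EuclideanSpace ℝ ι, exp (-U (ω + ψ)) * U' (ω + ψ) (EuclideanSpace.single z (1 : ℝ))
            ∂(multivariateGaussian 0 (A * Aᵀ)))))) ∂(multivariateGaussian 0 (A * Aᵀ))) + (∫ ω : EuclideanSpace ℝ ι, exp (-U (ω + ψ))
            ∂(multivariateGaussian 0 (A * Aᵀ)))⁻¹ * (∫ ω : EuclideanSpace ℝ ι, exp (-U (ω + ψ)) * ((U' (ω + ψ) (EuclideanSpace.single x (1 : ℝ)) -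
            ((∫ ω : EuclideanSpace ℝ ι, exp (-U (ω + ψ)) ∂(multivariateGaussian 0 (A * Aᵀ)))⁻¹ * (∫ ω : EuclideanSpace ℝ ι, exp (-U (ω + ψ)) * U' (ω
            + ψ) (EuclideanSpace.single x (1 : ℝ)) ∂(multivariateGaussian 0 (A * Aᵀ))))) * (U'' (ω + ψ) (EuclideanSpace.single y (1 : ℝ))
            (EuclideanSpace.single z (1 : ℝ)) - ((∫ ω : EuclideanSpace ℝ ι, exp (-U (ω + ψ)) ∂(multivariateGaussian 0 (A * Aᵀ)))⁻¹ * (∫ ω :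
            EuclideanSpace ℝ ι, exp (-U (ω + ψ)) * U'' (ω + ψ) (EuclideanSpace.single y (1 : ℝ)) (EuclideanSpace.single z (1 : ℝ))
            ∂(multivariateGaussian 0 (A * Aᵀ))))) * (U' (ω + ψ) (EuclideanSpace.single t (1 : ℝ)) - ((∫ ω : EuclideanSpace ℝ ι, exp (-U (ω + ψ))
            ∂(multivariateGaussian 0 (A * Aᵀ)))⁻¹ * (∫ ω : EuclideanSpace ℝ ι, exp (-U (ω + ψ)) * U' (ω + ψ) (EuclideanSpace.single t (1 : ℝ))
            ∂(multivariateGaussian 0 (A * Aᵀ)))))) ∂(multivariateGaussian 0 (A * Aᵀ))) + (∫ ω : EuclideanSpace ℝ ι, exp (-U (ω + ψ))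
            ∂(multivariateGaussian 0 (A * Aᵀ)))⁻¹ * (∫ ω : EuclideanSpace ℝ ι, exp (-U (ω + ψ)) * ((U' (ω + ψ) (EuclideanSpace.single x (1 : ℝ)) -
            ((∫ ω : EuclideanSpace ℝ ι, exp (-U (ω + ψ)) ∂(multivariateGaussian 0 (A * Aᵀ)))⁻¹ * (∫ ω : EuclideanSpace ℝ ι, exp (-U (ω + ψ)) * U' (ω
            + ψ) (EuclideanSpace.single x (1 : ℝ)) ∂(multivariateGaussian 0 (A * Aᵀ))))) * (U'' (ω + ψ) (EuclideanSpace.single y (1 : ℝ))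
            (EuclideanSpace.single t (1 : ℝ)) - ((∫ ω : EuclideanSpace ℝ ι, exp (-U (ω + ψ)) ∂(multivariateGaussian 0 (A * Aᵀ)))⁻¹ * (∫ ω :
            EuclideanSpace ℝ ι, exp (-U (ω + ψ)) * U'' (ω + ψ) (EuclideanSpace.single y (1 : ℝ)) (EuclideanSpace.single t (1 : ℝ))
            ∂(multivariateGaussian 0 (A * Aᵀ))))) * (U' (ω + ψ) (EuclideanSpace.single z (1 : ℝ)) - ((∫ ω : EuclideanSpace ℝ ι, exp (-U (ω + ψ))
            ∂(multivariateGaussian 0 (A * Aᵀ)))⁻¹ * (∫ ω : EuclideanSpace ℝ ι, exp (-U (ω + ψ)) * U' (ω + ψ) (EuclideanSpace.single z (1 : ℝ))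
            ∂(multivariateGaussian 0 (A * Aᵀ)))))) ∂(multivariateGaussian 0 (A * Aᵀ))) + (∫ ω : EuclideanSpace ℝ ι, exp (-U (ω + ψ))
            ∂(multivariateGaussian 0 (A * Aᵀ)))⁻¹ * (∫ ω : EuclideanSpace ℝ ι, exp (-U (ω + ψ)) * ((U' (ω + ψ) (EuclideanSpace.single x (1 : ℝ)) -
            ((∫ ω : EuclideanSpace ℝ ι, exp (-U (ω + ψ)) ∂(multivariateGaussian 0 (A * Aᵀ)))⁻¹ * (∫ ω : EuclideanSpace ℝ ι, exp (-U (ω + ψ)) * U' (ω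
            + ψ) (EuclideanSpace.single x (1 : ℝ)) ∂(multivariateGaussian 0 (A * Aᵀ))))) * (U'' (ω + ψ) (EuclideanSpace.single z (1 : ℝ))
            (EuclideanSpace.single t (1 : ℝ)) - ((∫ ω : EuclideanSpace ℝ ι, exp (-U (ω + ψ)) ∂(multivariateGaussian 0 (A * Aᵀ)))⁻¹ * (∫ ω :
            EuclideanSpace ℝ ι, exp (-U (ω + ψ)) * U'' (ω + ψ) (EuclideanSpace.single z (1 : ℝ)) (EuclideanSpace.single t (1 : ℝ))
            ∂(multivariateGaussian 0 (A * Aᵀ))))) * (U' (ω + ψ) (EuclideanSpace.single y (1 : ℝ)) - ((∫ ω : EuclideanSpace ℝ ι, exp (-U (ω + ψ))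
            ∂(multivariateGaussian 0 (A * Aᵀ)))⁻¹ * (∫ ω : EuclideanSpace ℝ ι, exp (-U (ω + ψ)) * U' (ω + ψ) (EuclideanSpace.single y (1 : ℝ))
            ∂(multivariateGaussian 0 (A * Aᵀ)))))) ∂(multivariateGaussian 0 (A * Aᵀ)))) -
        ((∫ ω : EuclideanSpace ℝ ι, exp (-U (ω + ψ)) ∂(multivariateGaussian 0 (A * Aᵀ)))⁻¹ * (∫ ω : EuclideanSpace ℝ ι, exp (-U (ω + ψ)) * ((U' (ω +
            ψ) (EuclideanSpace.single x (1 : ℝ)) - ((∫ ω : EuclideanSpace ℝ ι, exp (-U (ω + ψ)) ∂(multivariateGaussian 0 (A * Aᵀ)))⁻¹ * (∫ ω :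
            EuclideanSpace ℝ ι, exp (-U (ω + ψ)) * U' (ω + ψ) (EuclideanSpace.single x (1 : ℝ)) ∂(multivariateGaussian 0 (A * Aᵀ))))) * (U' (ω + ψ)
            (EuclideanSpace.single y (1 : ℝ)) - ((∫ ω : EuclideanSpace ℝ ι, exp (-U (ω + ψ)) ∂(multivariateGaussian 0 (A * Aᵀ)))⁻¹ * (∫ ω :
            EuclideanSpace ℝ ι, exp (-U (ω + ψ)) * U' (ω + ψ) (EuclideanSpace.single y (1 : ℝ)) ∂(multivariateGaussian 0 (A * Aᵀ))))) * (U' (ω + ψ)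
            (EuclideanSpace.single z (1 : ℝ)) - ((∫ ω : EuclideanSpace ℝ ι, exp (-U (ω + ψ)) ∂(multivariateGaussian 0 (A * Aᵀ)))⁻¹ * (∫ ω :
            EuclideanSpace ℝ ι, exp (-U (ω + ψ)) * U' (ω + ψ) (EuclideanSpace.single z (1 : ℝ)) ∂(multivariateGaussian 0 (A * Aᵀ))))) * (U' (ω + ψ)
            (EuclideanSpace.single t (1 : ℝ)) - ((∫ ω : EuclideanSpace ℝ ι, exp (-U (ω + ψ)) ∂(multivariateGaussian 0 (A * Aᵀ)))⁻¹ * (∫ ω :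
            EuclideanSpace ℝ ι, exp (-U (ω + ψ)) * U' (ω + ψ) (EuclideanSpace.single t (1 : ℝ)) ∂(multivariateGaussian 0 (A * Aᵀ))))))
            ∂(multivariateGaussian 0 (A * Aᵀ))) - ((∫ ω : EuclideanSpace ℝ ι, exp (-U (ω + ψ)) ∂(multivariateGaussian 0 (A * Aᵀ)))⁻¹ * (∫ ω :
            EuclideanSpace ℝ ι, exp (-U (ω + ψ)) * ((U' (ω + ψ) (EuclideanSpace.single x (1 : ℝ)) - ((∫ ω : EuclideanSpace ℝ ι, exp (-U (ω + ψ))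
            ∂(multivariateGaussian 0 (A * Aᵀ)))⁻¹ * (∫ ω : EuclideanSpace ℝ ι, exp (-U (ω + ψ)) * U' (ω + ψ) (EuclideanSpace.single x (1 : ℝ))
            ∂(multivariateGaussian 0 (A * Aᵀ))))) * (U' (ω + ψ) (EuclideanSpace.single y (1 : ℝ)) - ((∫ ω : EuclideanSpace ℝ ι, exp (-U (ω + ψ))
            ∂(multivariateGaussian 0 (A * Aᵀ)))⁻¹ * (∫ ω : EuclideanSpace ℝ ι, exp (-U (ω + ψ)) * U' (ω + ψ) (EuclideanSpace.single y (1 : ℝ))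
            ∂(multivariateGaussian 0 (A * Aᵀ)))))) ∂(multivariateGaussian 0 (A * Aᵀ)))) * ((∫ ω : EuclideanSpace ℝ ι, exp (-U (ω + ψ))
            ∂(multivariateGaussian 0 (A * Aᵀ)))⁻¹ * (∫ ω : EuclideanSpace ℝ ι, exp (-U (ω + ψ)) * ((U' (ω + ψ) (EuclideanSpace.single z (1 : ℝ)) -
            ((∫ ω : EuclideanSpace ℝ ι, exp (-U (ω + ψ)) ∂(multivariateGaussian 0 (A * Aᵀ)))⁻¹ * (∫ ω : EuclideanSpace ℝ ι, exp (-U (ω + ψ)) * U' (ω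
            + ψ) (EuclideanSpace.single z (1 : ℝ)) ∂(multivariateGaussian 0 (A * Aᵀ))))) * (U' (ω + ψ) (EuclideanSpace.single t (1 : ℝ)) - ((∫ ω :
            EuclideanSpace ℝ ι, exp (-U (ω + ψ)) ∂(multivariateGaussian 0 (A * Aᵀ)))⁻¹ * (∫ ω : EuclideanSpace ℝ ι, exp (-U (ω + ψ)) * U' (ω + ψ)
            (EuclideanSpace.single t (1 : ℝ)) ∂(multivariateGaussian 0 (A * Aᵀ)))))) ∂(multivariateGaussian 0 (A * Aᵀ)))) - ((∫ ω : EuclideanSpace ℝ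
            ι, exp (-U (ω + ψ)) ∂(multivariateGaussian 0 (A * Aᵀ)))⁻¹ * (∫ ω : EuclideanSpace ℝ ι, exp (-U (ω + ψ)) * ((U' (ω + ψ)
            (EuclideanSpace.single x (1 : ℝ)) - ((∫ ω : EuclideanSpace ℝ ι, exp (-U (ω + ψ)) ∂(multivariateGaussian 0 (A * Aᵀ)))⁻¹ * (∫ ω :
            EuclideanSpace ℝ ι, exp (-U (ω + ψ)) * U' (ω + ψ) (EuclideanSpace.single x (1 : ℝ)) ∂(multivariateGaussian 0 (A * Aᵀ))))) * (U' (ω + ψ)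
            (EuclideanSpace.single z (1 : ℝ)) - ((∫ ω : EuclideanSpace ℝ ι, exp (-U (ω + ψ)) ∂(multivariateGaussian 0 (A * Aᵀ)))⁻¹ * (∫ ω :
            EuclideanSpace ℝ ι, exp (-U (ω + ψ)) * U' (ω + ψ) (EuclideanSpace.single z (1 : ℝ)) ∂(multivariateGaussian 0 (A * Aᵀ))))))
            ∂(multivariateGaussian 0 (A * Aᵀ)))) * ((∫ ω : EuclideanSpace ℝ ι, exp (-U (ω + ψ)) ∂(multivariateGaussian 0 (A * Aᵀ)))⁻¹ * (∫ ω :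
            EuclideanSpace ℝ ι, exp (-U (ω + ψ)) * ((U' (ω + ψ) (EuclideanSpace.single y (1 : ℝ)) - ((∫ ω : EuclideanSpace ℝ ι, exp (-U (ω + ψ))
            ∂(multivariateGaussian 0 (A * Aᵀ)))⁻¹ * (∫ ω : EuclideanSpace ℝ ι, exp (-U (ω + ψ)) * U' (ω + ψ) (EuclideanSpace.single y (1 : ℝ))
            ∂(multivariateGaussian 0 (A * Aᵀ))))) * (U' (ω + ψ) (EuclideanSpace.single t (1 : ℝ)) - ((∫ ω : EuclideanSpace ℝ ι, exp (-U (ω + ψ))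
            ∂(multivariateGaussian 0 (A * Aᵀ)))⁻¹ * (∫ ω : EuclideanSpace ℝ ι, exp (-U (ω + ψ)) * U' (ω + ψ) (EuclideanSpace.single t (1 : ℝ))
            ∂(multivariateGaussian 0 (A * Aᵀ)))))) ∂(multivariateGaussian 0 (A * Aᵀ)))) - ((∫ ω : EuclideanSpace ℝ ι, exp (-U (ω + ψ))
            ∂(multivariateGaussian 0 (A * Aᵀ)))⁻¹ * (∫ ω : EuclideanSpace ℝ ι, exp (-U (ω + ψ)) * ((U' (ω + ψ) (EuclideanSpace.single x (1 : ℝ)) -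
            ((∫ ω : EuclideanSpace ℝ ι, exp (-U (ω + ψ)) ∂(multivariateGaussian 0 (A * Aᵀ)))⁻¹ * (∫ ω : EuclideanSpace ℝ ι, exp (-U (ω + ψ)) * U' (ω
            + ψ) (EuclideanSpace.single x (1 : ℝ)) ∂(multivariateGaussian 0 (A * Aᵀ))))) * (U' (ω + ψ) (EuclideanSpace.single t (1 : ℝ)) - ((∫ ω :
            EuclideanSpace ℝ ι, exp (-U (ω + ψ)) ∂(multivariateGaussian 0 (A * Aᵀ)))⁻¹ * (∫ ω : EuclideanSpace ℝ ι, exp (-U (ω + ψ)) * U' (ω + ψ)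
            (EuclideanSpace.single t (1 : ℝ)) ∂(multivariateGaussian 0 (A * Aᵀ)))))) ∂(multivariateGaussian 0 (A * Aᵀ)))) * ((∫ ω : EuclideanSpace ℝ
            ι, exp (-U (ω + ψ)) ∂(multivariateGaussian 0 (A * Aᵀ)))⁻¹ * (∫ ω : EuclideanSpace ℝ ι, exp (-U (ω + ψ)) * ((U' (ω + ψ)
            (EuclideanSpace.single y (1 : ℝ)) - ((∫ ω : EuclideanSpace ℝ ι, exp (-U (ω + ψ)) ∂(multivariateGaussian 0 (A * Aᵀ)))⁻¹ * (∫ ω :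
            EuclideanSpace ℝ ι, exp (-U (ω + ψ)) * U' (ω + ψ) (EuclideanSpace.single y (1 : ℝ)) ∂(multivariateGaussian 0 (A * Aᵀ))))) * (U' (ω + ψ)
            (EuclideanSpace.single z (1 : ℝ)) - ((∫ ω : EuclideanSpace ℝ ι, exp (-U (ω + ψ)) ∂(multivariateGaussian 0 (A * Aᵀ)))⁻¹ * (∫ ω :
            EuclideanSpace ℝ ι, exp (-U (ω + ψ)) * U' (ω + ψ) (EuclideanSpace.single z (1 : ℝ)) ∂(multivariateGaussian 0 (A * Aᵀ))))))
            ∂(multivariateGaussian 0 (A * Aᵀ)))))| ≤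
      κ₄r + (3 * (αr * k4r * (αc * hc)) + hr * αr * (αc * k4c) + 3 * (αr * k3r * (αc * k3c))) * dr * dc / (1 - lamA) +
        6 * (n * (4 * Real.sqrt ((5 * ((κ₂ ^ 4 + κ₃ ^ 4) * γop ^ 2) / (1 - lam * γop) ^ 2) * (αθ * dθ * (βθ * dθ') / (1 - lamA))) * S ^ 2)) +
        (4 * (αθ * dθ * (βθ * dθ') / (1 - lamA)) + 3 * (αθ * dθ * (βθ * dθ') / (1 - lamA)) ^ 2 + 4 * (5 * (κ₂ ^ 4 * γop ^ 2) / (1 - lam * γop) ^ 2) +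
            4
          * (50 * (κ₂ ^ 6 * γop ^ 3) / (1 - lam * γop) ^ 3) + 2 * (((5 * (κ₂ ^ 4 * γop ^ 2) / (1 - lam * γop) ^ 2) + 1) / 2) * ((((5 * (κ₂ ^ 4 * γop
              ^ 2) / (1 - lam * γop) ^ 2) + 1) / 2) + (5 *
          (κ₂ ^ 4 * γop ^ 2) / (1 - lam * γop) ^ 2))) * (16 * S' ^ 3) := by
  have hΓ : (A * Aᵀ).PosSemidef := posSemidef_AAT A
  have hU''c : Continuous U'' := continuous_iff_continuousAt.2 fun φ => (hU''d φ).continuousAt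
  have hU₃c : Continuous U₃ := continuous_iff_continuousAt.2 fun φ => (hU₃d φ).continuousAt
  have hκθ' : 2 * κ₀ * (1 + τ) * γop ≤ θp := mul_opBound_le_of_le (by positivity) (by linarith) hθ0.le hκθ
  have hl1 : 0 < 1 - lamA := by linarith
  -- the fifteen pieces' triple row sums ((500); (501)∕(502)+(512); (511); (522)), the other placements by (522)'s reindexings
  have h1 := tilted_fourth_average_rowsum hΓ hΓop Y hUd hU₄c hκ₀ hτ hδ hθ0 hθ1 hκθ hstab hU₄b hU₄row ψ x
  have h2 := (sum3_cycle _).trans_le ((Finset.sum_le_sum fun y _ => Finset.sum_le_sum fun z _ => Finset.sum_le_sum fun t _ => thirdgrad_cov_entry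
      hΓop Y hUd hU'd hU₃d hHk hHk0 hK4 hκ₀ hτ hδ hθ1 hκθ' hκθw hstab ψ hαr hαc hhr hlamA hlamA1 hγ hγ1 hD hDC x y z t).trans
      (two_point_lone_last_sum_le hK40 hHk0 hαr hαc hhc hk4r hD hDr hDc hl1 x))
  have h3 := (sum3_swap23 _).trans_le ((Finset.sum_le_sum fun y _ => Finset.sum_le_sum fun z _ => Finset.sum_le_sum fun t _ => thirdgrad_cov_entry
      hΓop Y hUd hU'd hU₃d hHk hHk0 hK4 hκ₀ hτ hδ hθ1 hκθ' hκθw hstab ψ hαr hαc hhr hlamA hlamA1 hγ hγ1 hD hDC x y z t).trans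
      (two_point_lone_last_sum_le hK40 hHk0 hαr hαc hhc hk4r hD hDr hDc hl1 x))
  have h4 := (Finset.sum_le_sum fun y _ => Finset.sum_le_sum fun z _ => Finset.sum_le_sum fun t _ => thirdgrad_cov_entry hΓop Y hUd hU'd hU₃d hHk
      hHk0 hK4 hκ₀ hτ hδ hθ1 hκθ' hκθw hstab ψ hαr hαc hhr hlamA hlamA1 hγ hγ1 hD hDC x y z t).trans (two_point_lone_last_sum_le hK40 hHk0 hαr hαc
      hhc hk4r hD hDr hDc hl1 x)
  have h5 := (Finset.sum_le_sum fun y _ => Finset.sum_le_sum fun z _ => Finset.sum_le_sum fun t _ => gradthird_cov_entry hΓop Y hUd hU'd hU₃d hHk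
      hHk0 hK4 hκ₀ hτ hδ hθ1 hκθ' hκθw hstab ψ hαr hαc hhr hlamA hlamA1 hγ hγ1 hD hDC x y z t).trans (two_point_lone_first_sum_le hK40 hHk0 hαr hαc
      hhr hk4c hD hDr hDc hl1 x)
  have h6 := (Finset.sum_le_sum fun y _ => Finset.sum_le_sum fun z _ => Finset.sum_le_sum fun t _ => hesshess_cov_entry hΓop Y hUd hU'd hU''d hHk
      hHk0 hK3 hκ₀ hτ hδ hθ1 hκθ' hκθw hstab ψ hαr hαc hhr hlamA hlamA1 hγ hγ1 hD hDC x y z t).trans (two_point_pairing_sum_le hK30 hαr hαc hk3r hk3c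
      hD hDr hDc hl1 x)
  have h7 := (sum3_swap12 _).trans_le ((Finset.sum_le_sum fun y _ => Finset.sum_le_sum fun z _ => Finset.sum_le_sum fun t _ => hesshess_cov_entry
      hΓop Y hUd hU'd hU''d hHk hHk0 hK3 hκ₀ hτ hδ hθ1 hκθ' hκθw hstab ψ hαr hαc hhr hlamA hlamA1 hγ hγ1 hD hDC x y z t).trans
      (two_point_pairing_sum_le hK30 hαr hαc hk3r hk3c hD hDr hDc hl1 x))
  have h8 := (sum3_cycle' _).trans_le ((Finset.sum_le_sum fun y _ => Finset.sum_le_sum fun z _ => Finset.sum_le_sum fun t _ => hesshess_cov_entry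
      hΓop Y hUd hU'd hU''d hHk hHk0 hK3 hκ₀ hτ hδ hθ1 hκθ' hκθw hstab ψ hαr hαc hhr hlamA hlamA1 hγ hγ1 hD hDC x y z t).trans
      (two_point_pairing_sum_le hK30 hαr hαc hk3r hk3c hD hDr hDc hl1 x))
  have h9 := mixed_three_point_row_letter hΓop Y hUd hU'd hU''d hU₃c hκ₀ hκ₁ ha hτ hδ hθ0 hθ1 hκθ hκθw hstab hU'b hU''b hU₃b hlam hUsec hρg hHk hHk0
      hK3 hK30 ψ hαr hαc hhr hlamA hlamA1 hγ hγ1 hD hDC hθnn hDθr hdθ hDθc hdθ' hσ0 hσθ hρ1 hρsymm hρmul hρσ haσ hβ haσ' hgσ hgσ' x hS (hn x)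
  have h10 := (sum3_swap12 _).trans_le (mixed_three_point_row_letter hΓop Y hUd hU'd hU''d hU₃c hκ₀ hκ₁ ha hτ hδ hθ0 hθ1 hκθ hκθw hstab hU'b hU''b
      hU₃b hlam hUsec hρg hHk hHk0 hK3 hK30 ψ hαr hαc hhr hlamA hlamA1 hγ hγ1 hD hDC hθnn hDθr hdθ hDθc hdθ' hσ0 hσθ hρ1 hρsymm hρmul hρσ haσ hβ haσ'
      hgσ hgσ' x hS (hn x))
  have h11 := (sum3_cycle' _).trans_le (mixed_three_point_row_letter hΓop Y hUd hU'd hU''d hU₃c hκ₀ hκ₁ ha hτ hδ hθ0 hθ1 hκθ hκθw hstab hU'b hU''b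
      hU₃b hlam hUsec hρg hHk hHk0 hK3 hK30 ψ hαr hαc hhr hlamA hlamA1 hγ hγ1 hD hDC hθnn hDθr hdθ hDθc hdθ' hσ0 hσθ hρ1 hρsymm hρmul hρσ haσ hβ haσ'
      hgσ hgσ' x hS (hn x))
  have h12 := mixed_three_point_row_letter_two hΓop Y hUd hU'd hU''d hU₃c hκ₀ hκ₁ ha hτ hδ hθ0 hθ1 hκθ hκθw hstab hU'b hU''b hU₃b hlam hUsec hρg hHk
      hHk0 hK3 hK30 ψ hαr hαc hhr hlamA hlamA1 hγ hγ1 hD hDC hθnn hDθr hdθ hDθc hdθ' hσ0 hσθ hρ1 hρsymm hρmul hρσ haσ hβ haσ' hgσ hgσ' x hS hn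
  have h13 := (sum3_swap23 _).trans_le (mixed_three_point_row_letter_two hΓop Y hUd hU'd hU''d hU₃c hκ₀ hκ₁ ha hτ hδ hθ0 hθ1 hκθ hκθw hstab hU'b
      hU''b hU₃b hlam hUsec hρg hHk hHk0 hK3 hK30 ψ hαr hαc hhr hlamA hlamA1 hγ hγ1 hD hDC hθnn hDθr hdθ hDθc hdθ' hσ0 hσθ hρ1 hρsymm hρmul hρσ haσ
      hβ haσ' hgσ hgσ' x hS hn)
  have h14 := (sum3_cycle _).trans_le (mixed_three_point_row_letter_two hΓop Y hUd hU'd hU''d hU₃c hκ₀ hκ₁ ha hτ hδ hθ0 hθ1 hκθ hκθw hstab hU'b hU''b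
      hU₃b hlam hUsec hρg hHk hHk0 hK3 hK30 ψ hαr hαc hhr hlamA hlamA1 hγ hγ1 hD hDC hθnn hDθr hdθ hDθc hdθ' hσ0 hσθ hρ1 hρsymm hρmul hρσ haσ hβ haσ'
      hgσ hgσ' x hS hn)
  have h15 := fourth_cumulant_row_letter_tilted hΓop Y hUd hU'd hU''c hκ₀ hκ₁ ha hτ hδ hθ0 hθ1 hκθ hκθw hstab hU'b hU''b hlam hUsec hρg hHk hHk0 ψ
      hαr hαc hhr hlamA hlamA1 hγ hγ1 hD hDC hθnn hDθr hdθ hDθc hdθ' hσ0 hσθ hr1 hrσ haσ hβ haσ' hSr hSc x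
  beta_reduce at h2 h3 h7 h8 h10 h11 h13 h14
  -- assemble
  refine (Finset.sum_le_sum fun y _ => Finset.sum_le_sum fun z _ => Finset.sum_le_sum fun t _ => abs_fifteen_split _ _ _ _ _ _ _ _ _ _ _ _ _ _
      _).trans ?_
  simp only [Finset.sum_add_distrib]
  have hsum := add_le_add (add_le_add (add_le_add (add_le_add (add_le_add (add_le_add (add_le_add (add_le_add (add_le_add (add_le_add (add_le_add
    (add_le_add (add_le_add (add_le_add h1 h2) h3) h4) h5) h6) h7) h8) h9) h10) h11) h12) h13) h14) h15
  refine hsum.trans (le_of_eq ?_)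
  ring

end TheEnd

/-! ## §2. Toy -/

/-- Toy (the assembly's arithmetic): three equal two-point letters collect into `3·L`. -/
example (L : ℝ) : L + L + L = 3 * L := by ring

end Summit.QuantumFields.BalabanUV.T4Continuum.NE7b.SupWhitenedFourthKernelLetter

end
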